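import Mathlib
import Summits.Ventures.PercRepro.TriangleCapSubBandTop

/-!
# PercRepro — THE BOTTOM OF EVERY SUB-BAND IS ATTAINED: THE `K_{2,u}` THROUGH THE CENTRE (p3, gen 52; part 262)

THE BOTTOM WITNESS (`bottomWitness`): on `ℓ + 1 + (s − t)` vertices (`2 ≤ ℓ`, `2 u ≤ t`, `1 ≤ u`, `2 t ≤ s`) the
`(t − u)`-star at the non-neighbour `1` with all ends at leaves, plus `u` edges from the non-neighbour `2` to the
first `u` leaves of the star — the `K_{2,u}` through `1` and `2`: `attach = t`, `coll lf = (t − u)(t − u − 1) +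
u (u − 1)`, `coll rf = 2 u` (the pairs `(i, i + (t − u))` and their mirrors, `i < u`), so `2 j = 2 u (t − u − 1)`: the
sub-band bottom of part 252 is attained.  With part 261 both ends of every sub-band `u` (`u + 1 ≤ t`, `2 u ≤ t`) are
attained; its interior is the census's (§10df(a)) and a successor's.  Axioms: standard.
-/

namespace PercRepro

namespace TriangleCap

namespace C047

open Finset

/-- The right ends of the bottom witness: the leaves `3, 4, …` for the star, the first `u` of them again for the
off-edges. -/
def rfBot (t u i : ℕ) : ℕ := if i < t - u then 3 + i else 3 + (i - (t - u))

/-- `coll` of the bottom witness's right ends: `2 u`. -/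
theorem coll_rfBot (t u : ℕ) (hu : 2 * u ≤ t) : coll t (rfBot t u) = 2 * u := by
  unfold coll
  set d := t - u with hd
  have hset : (range t).offDiag.filter (fun p : ℕ × ℕ => rfBot t u p.1 = rfBot t u p.2) =
      (range u).image (fun i => (i, i + d)) ∪ (range u).image (fun i => (i + d, i)) := by
    ext ⟨i, i'⟩
    simp only [mem_filter, mem_offDiag, mem_range, mem_union, mem_image, Prod.mk.injEq]
    unfold rfBot
    rw [← hd]
    constructor
    · rintro ⟨⟨h1, h2, h3⟩, h4⟩
      by_cases hi : i < d
      · rw [if_pos hi] at h4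
        by_cases hi' : i' < d
        · rw [if_pos hi'] at h4
          omega
        · rw [if_neg hi'] at h4
          left
          exact ⟨i, by omega, rfl, by omega⟩
      · rw [if_neg hi] at h4
        by_cases hi' : i' < d
        · rw [if_pos hi'] at h4
          right
          exact ⟨i', by omega, by omega, rfl⟩
        · rw [if_neg hi'] at h4
          omega
    · rintro (⟨x, hx, rfl, rfl⟩ | ⟨x, hx, rfl, rfl⟩)
      · refine ⟨⟨by omega, by omega, by omega⟩, ?_⟩
        rw [if_pos (by omega), if_neg (by omega)]
        omega
      · refine ⟨⟨by omega, by omega, by omega⟩, ?_⟩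
        rw [if_neg (by omega), if_pos (by omega)]
        omega
  rw [hset, card_union_of_disjoint, card_image_of_injective, card_image_of_injective, card_range]
  · ring
  · intro x y h
    rw [Prod.mk.injEq] at h
    exact h.2
  · intro x y h
    rw [Prod.mk.injEq] at h
    exact h.1
  · rw [disjoint_left]
    intro p hp hp'
    rw [mem_image] at hp hp'
    obtain ⟨x, hx, rfl⟩ := hp
    obtain ⟨y, hy, hxy⟩ := hp'
    rw [Prod.mk.injEq] at hxy
    rw [mem_range] at hx hy
    omega

/-- **THE BOTTOM WITNESS:** for `2 ≤ ℓ`, `1 ≤ u`, `2 u ≤ t`, `2 t ≤ s`, the sub-band bottom `j = u (t − u − 1)` is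
attained on `ℓ + 1 + (s − t)` vertices. -/
theorem bottomWitness (ℓ s t u : ℕ) (hℓ : 2 ≤ ℓ) (hu : 1 ≤ u) (hut : 2 * u ≤ t) (hs : 2 * t ≤ s) :
    ∃ (H : SimpleGraph (Fin (ℓ + 1 + (s - t)))) (_ : DecidableRel H.Adj), H.CliqueFree 3 ∧
      H.edgeFinset.card = s ∧ (∃ w, deg H w + t = s) ∧
      ∑ v, deg H v * deg H v + 2 * (t * (s - t - 1)) + 2 * (u * (t - u - 1)) = s * (s + 1) := by
  set n := ℓ + 1 + (s - t) with hn
  have hn0 : 0 < n := by omega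
  have hg : GoodEnds n 3 t (lfTop t u 1) (rfBot t u) := by
    refine ⟨fun i hi => ?_, fun i hi => ?_, fun i i' hi hi' h1 h2 => ?_⟩
    · unfold lfTop
      have := lfRR_bounds 1 0 (i - (t - u)) le_rfl
      split_ifs <;> omega
    · unfold rfBot
      split_ifs <;> omega
    · have hb1 := lfRR_bounds 1 0 (i - (t - u)) le_rfl
      have hb2 := lfRR_bounds 1 0 (i' - (t - u)) le_rfl
      unfold lfTop at h1
      unfold rfBot at h2
      split_ifs at h1 h2 <;> omega
  have hval := genWitness_missing_value n 3 s t hn0 (lfTop t u 1) (rfBot t u) hg (by omega) (by omega) (by omega)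
    (by omega)
  have hatt : ((range t).filter (fun i => rfBot t u i < 3 + (s - t))).card = t := by
    have : (range t).filter (fun i => rfBot t u i < 3 + (s - t)) = range t := by
      apply filter_true_of_mem
      intro i hi
      rw [mem_range] at hi
      unfold rfBot
      split_ifs <;> omega
    rw [this, card_range]
  rw [hatt, coll_rfBot t u hut, coll_lfTop t u 1 (by omega) le_rfl, coll_lfRR_zero 1 u Nat.one_pos, Nat.div_one,
    Nat.mod_one, Nat.sub_self] at hval
  refine ⟨_, inferInstance, cliqueFree_of_bipSub _ _ (bipSub_missingGraph _ _),
    card_edges_missingGraph_genWitness n 3 s t hn0 (lfTop t u 1) (rfBot t u) hg (by omega) (by omega) (by omega),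
    ⟨fin' n hn0 0, by
      rw [deg_missingGraph_genWitness_zero n 3 s t hn0 (lfTop t u 1) (rfBot t u) hg (by omega) (by omega)]
      omega⟩, ?_⟩
  have hid := subband_identity t u (by omega)
  have e : 2 * 0 + (t * (t - 1) - ((t - u) * (t - u - 1) + (1 * (u * (u - 1)) + 2 * (0 * u)) + 2 * u)) =
      2 * (u * (t - u - 1)) := by
    have e1 : u * (u + 1) = u * (u - 1) + 2 * u := by
      obtain ⟨u', rfl⟩ : ∃ u', u = u' + 1 := ⟨u - 1, by omega⟩
      rw [Nat.add_sub_cancel]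
      ring
    simp only [mul_zero, zero_mul, add_zero, one_mul, zero_add]
    omega
  rw [e] at hval
  exact hval

/-- **BOTH ENDS OF EVERY SUB-BAND ARE ATTAINED** (`2 ≤ ℓ`, `ℓ ≤ u + 1`, `1 ≤ u`, `2 u ≤ t`, `2 t ≤ s`): the bottom
`j = u (t − u − 1)` and the top `2 j = 2 u (t − u − 1) + u (u + 1) − 2 q u + (ℓ − 1) q (q + 1)`, `q = ⌊u / (ℓ − 1)⌋`,
while every value of the sub-band `u` (a non-neighbour of off-degree `t − u`) lies between them. -/
theorem subband_ends (ℓ s t u : ℕ) (hℓ : 2 ≤ ℓ) (hℓu : ℓ ≤ u + 1) (hu : 1 ≤ u) (hut : 2 * u ≤ t) (hs : 2 * t ≤ s) :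
    (∃ (H : SimpleGraph (Fin (ℓ + 1 + (s - t)))) (_ : DecidableRel H.Adj), H.CliqueFree 3 ∧
      H.edgeFinset.card = s ∧ (∃ w, deg H w + t = s) ∧
      ∑ v, deg H v * deg H v + 2 * (t * (s - t - 1)) + 2 * (u * (t - u - 1)) = s * (s + 1)) ∧
    (∃ (H : SimpleGraph (Fin (ℓ + 1 + (s - t)))) (_ : DecidableRel H.Adj), H.CliqueFree 3 ∧
      H.edgeFinset.card = s ∧ (∃ w, deg H w + t = s) ∧
      ∑ v, deg H v * deg H v + 2 * (t * (s - t - 1)) +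
        (2 * (u * (t - u - 1)) + u * (u + 1) + (ℓ - 1) * ((u / (ℓ - 1)) * (u / (ℓ - 1) + 1)) -
          2 * (u / (ℓ - 1)) * u) = s * (s + 1)) ∧
    (∀ (H : SimpleGraph (Fin (ℓ + 1 + (s - t)))) [DecidableRel H.Adj], H.CliqueFree 3 →
      H.edgeFinset.card = s → ∀ w, deg H w + t = s → ∀ j,
      ∑ v, deg H v * deg H v + 2 * (t * (s - t - 1)) + 2 * j = s * (s + 1) →
      ∀ x, offDeg H w x + u = t → ¬ H.Adj w x →
        u * (t - u - 1) ≤ j ∧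
          2 * j + 2 * ((u / (ℓ - 1)) * u) ≤ 2 * (u * (t - u - 1)) + u * (u + 1) +
            (ℓ - 1) * ((u / (ℓ - 1)) * (u / (ℓ - 1) + 1))) := by
  refine ⟨bottomWitness ℓ s t u hℓ hu hut hs, subband_top_attained ℓ s t u hℓ hℓu (by omega) hs,
    fun H _ hfree hs' w hw j hj x hx hxw => ?_⟩
  have hw1 : 1 ≤ deg H w := by omega
  refine ⟨subband_lower_bound' H hfree s t u j hs' w hw1 hw hj x hx, ?_⟩
  have hcard := card_offEdges_add_deg H w
  exact subband_upper_bound_vertices ℓ s t H hfree hs' w hw hw1 u j hj x hx hxw (by omega) (u / (ℓ - 1))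
    (Nat.div_pos (by omega) (by omega))

end C047

end TriangleCap

end PercRepro
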